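import Summits.CriticalPhenomena.PercolationContinuityZ3.Theses.PercShatteringRace
import Summits.CriticalPhenomena.PercolationContinuityZ3.Theorems.NearLinearTwoClusterDecay.Negative.AspectRenorm
import Literature.Probability.Percolation.SharpnessDCTProofs
import Literature.Probability.Percolation.LatticeSymmetry
import Literature.Probability.Percolation.HalfSpaceBrickSymmetry
import HarnessLib

/-!
# Crux `PercShatteringRace.NearLinearTwoClusterDecay` (stmt-CriticalPhenomena-5785), line `critical-orange-peeling` — stub `slabCrossing_le_of_tiling`

Helper file for the lead's skeleton of the line `critical-orange-peeling` (van den Berg–van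
Engelenburg 2022 programme, bounded aspect; arXiv:2009.13337, Lemma 6 / Prop. 2, bond version on
`ℤ³`) of the crux
`Summit.CriticalPhenomena.PercolationContinuityZ3.Theses.PercShatteringRace.NearLinearTwoClusterDecay`.
Proves exactly the registered stub signature `slabCrossing_le_of_tiling` (item V7a of the
skeleton); lands with `--supports stmt-CriticalPhenomena-5785`.

## The statement (tiling a flat slab box by local one-arm events)

Bond percolation `P_p` on `ℤ³`, any `p`. Write `Λ(n) = box 3 n = [-n, n]³`,
`cross(n, R) = {∃ x ∈ Λ(n), ∃ y ∈ ∂ⁱⁿΛ(R), x ↔ y by an open path inside Λ(R)}` and, for `h ≤ b`,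
`V(b, h)` = "the slab box `Q = Λ(b) ∩ {|v₂| ≤ h}` has an open path inside `Q` from its bottom
layer `{v₂ = -h}` to its top layer `{v₂ = h}`". For `1 ≤ n`, `R + 1 ≤ 2h`:
`P_p(V(b, h)) ≤ 1 - (1 - P_p(cross(n, R)))^K`, `K = (2 ⌊b/n⌋ + 3)²`.

## The argument

* TILES. For `z ∈ box 2 (⌊b/n⌋ + 1)` put `c_z = (n z₀, n z₁, -h)` and let `T_v` be the translate
  by `v` of `cross(n, R)` (an `openCrossing` of three translated sets, as in
  `AspectRenorm`); `P_p(T_v) = P_p(cross(n, R))` (`AspectRenorm.real_openCrossing_add`).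
* INCLUSION (`SlabTiling.exists_tile_of_mem_slabCrossing`, on lattice configurations
  `ω ⊆ E(ℤ³)`, which carry full measure, `DCT16.real_mono_of_forall_subset_edgeSet`). Let `γ` be
  the open path inside `Q` from `x` (`x₂ = -h`, `|x₀|, |x₁| ≤ b`) to `y` (`y₂ = h`). Round `x`
  down to the grid: `z = (⌊x₀/n⌋, ⌊x₁/n⌋)`; then `x ∈ c_z + Λ(n)`, `|zᵢ| ≤ ⌊b/n⌋ + 1`, and
  `y ∉ c_z + Λ(R)` because `y₂ - (c_z)₂ = 2h > R`. For `n ≤ R` the first exit of `γ` from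
  `c_z + Λ(R)` gives `ω ∈ T_{c_z}` (`AspectRenorm.mem_openCrossing_of_pathIn`). (For `R < n`
  the event `cross(n, R)` is sure — the corner `(R, R, R) ∈ Λ(n) ∩ ∂ⁱⁿΛ(R)` is joined to itself —
  and the bound reads `P_p(V) ≤ 1`.)
* HARRIS (`SlabTiling.real_biUnion_le_one_sub_pow`). The `T_v` are increasing and local, so their
  complements are decreasing and positively correlated:
  `P_p(⋂_v T_vᶜ) ≥ ∏_v P_p(T_vᶜ) = (1 - P_p(cross(n, R)))^{|I|}`
  (`prob_biInter_ge_prod_of_isLowerSet`, Grimmett 1999 Thm. 2.4), whence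
  `P_p(⋃_{v ∈ I} T_v) ≤ 1 - (1 - P_p(cross(n, R)))^{|I|}`; finally `|I| ≤ |box 2 (⌊b/n⌋+1)| = K`
  (`card_box`).

No new definitions (the index set is an explicit `Finset.image` of `box 2 (⌊b/n⌋ + 1)`).
-/

noncomputable section

namespace Summit.CriticalPhenomena.PercolationContinuityZ3.Theorems.NearLinearTwoClusterDecay.Negative

open MeasureTheory Filter Topology
open Literature.Probability.LatticeModels Literature.Probability.Percolation
open Literature.Probability.Percolation.DCT16

namespace SlabTiling

/-! ### Geometry: a slab crossing contains a local one-arm crossing at some tile -/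

/-- **Grid rounding in one coordinate.** For `n ≥ 1` and `-b ≤ a ≤ b` (integers, `b ≥ 0`):
`-n ≤ a - n ⌊a/n⌋ ≤ n` (indeed `0 ≤ a mod n < n`) and `|⌊a/n⌋| ≤ ⌊b/n⌋ + 1`
(`⌊a/n⌋ ≤ ⌊b/n⌋` by monotonicity, `-(⌊b/n⌋ + 1) n < -b ≤ a`). -/
theorem round_bounds {n b : ℕ} (hn : 1 ≤ n) {a : ℤ} (hlo : -(b : ℤ) ≤ a) (hhi : a ≤ (b : ℤ)) :
    (-(n : ℤ) ≤ a - (n : ℤ) * (a / (n : ℤ)) ∧ a - (n : ℤ) * (a / (n : ℤ)) ≤ (n : ℤ)) ∧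
      (-((b / n + 1 : ℕ) : ℤ) ≤ a / (n : ℤ) ∧ a / (n : ℤ) ≤ ((b / n + 1 : ℕ) : ℤ)) := by
  have hn0 : (0 : ℤ) < n := by exact_mod_cast hn
  have h1 := Int.mul_ediv_add_emod a (n : ℤ)
  have h2 := Int.emod_nonneg a hn0.ne'
  have h3 := Int.emod_lt_of_pos a hn0
  have h4 := Int.mul_ediv_add_emod (b : ℤ) (n : ℤ)
  have h5 := Int.emod_lt_of_pos (b : ℤ) hn0
  have hup : a / (n : ℤ) ≤ (b : ℤ) / (n : ℤ) := Int.ediv_le_ediv hn0 hhi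
  have hlow : -((b : ℤ) / (n : ℤ) + 1) ≤ a / (n : ℤ) :=
    Int.le_ediv_of_mul_le hn0 (by linarith)
  refine ⟨⟨by omega, by omega⟩, ?_⟩
  push_cast
  exact ⟨hlow, by linarith⟩

/-- **Inclusion `V(b, h) ⊆ ⋃_z T_{c_z}` on lattice configurations.** Let `ω ⊆ E(ℤ³)` contain an
open path inside the slab box `Λ(b) ∩ {|v₂| ≤ h}` from a site `x` of the bottom layer
`{v₂ = -h}` to a site `y` of the top layer `{v₂ = h}`, and let `1 ≤ n ≤ R`, `R + 1 ≤ 2h`. With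
`z = (⌊x₀/n⌋, ⌊x₁/n⌋) ∈ box 2 (⌊b/n⌋ + 1)` and `c_z = (n z₀, n z₁, -h)`: `x ∈ c_z + Λ(n)`,
`y ∉ c_z + Λ(R)` (its height above `c_z` is `2h > R`), so the first exit of the path from
`c_z + Λ(R)` produces the translated local crossing `ω ∈ T_{c_z}`
(`AspectRenorm.mem_openCrossing_of_pathIn`). -/
theorem exists_tile_of_mem_slabCrossing {n R h b : ℕ} (hn : 1 ≤ n) (hnR : n ≤ R)
    (hRh : R + 1 ≤ 2 * h) {ω : BondConfig (Site 3)} (hω : ω ⊆ (zdGraph 3).edgeSet)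
    (hV : ω ∈ {ω | ∃ x ∈ (box 3 b).filter (fun v => v 2 = -(h : ℤ)),
      ∃ y ∈ (box 3 b).filter (fun v => v 2 = (h : ℤ)),
        ω ∈ openConnIn (↑((box 3 b).filter (fun v => -(h : ℤ) ≤ v 2 ∧ v 2 ≤ (h : ℤ))) :
          Set (Site 3)) x y}) :
    ∃ z ∈ box 2 (b / n + 1),
      ω ∈ openCrossing
        ((· + (![(n : ℤ) * z 0, (n : ℤ) * z 1, -(h : ℤ)] : Site 3)) '' (↑(box 3 R) : Set (Site 3)))
        ((· + (![(n : ℤ) * z 0, (n : ℤ) * z 1, -(h : ℤ)] : Site 3)) '' (↑(box 3 n) : Set (Site 3)))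
        ((· + (![(n : ℤ) * z 0, (n : ℤ) * z 1, -(h : ℤ)] : Site 3)) ''
          (↑(innerBoundary (zdGraph 3) (box 3 R)) : Set (Site 3))) := by
  obtain ⟨x, hx, y, hy, hxy⟩ := hV
  rw [Finset.mem_filter, mem_box] at hx hy
  obtain ⟨hxb, hx2⟩ := hx
  obtain ⟨-, hy2⟩ := hy
  have P := mem_openConnIn_iff_pathIn.1 hxy
  obtain ⟨⟨hr0, hr0'⟩, hz0, hz0'⟩ := round_bounds hn (hxb 0).1 (hxb 0).2
  obtain ⟨⟨hr1, hr1'⟩, hz1, hz1'⟩ := round_bounds hn (hxb 1).1 (hxb 1).2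
  refine ⟨![x 0 / (n : ℤ), x 1 / (n : ℤ)], ?_, ?_⟩
  · rw [mem_box]
    intro i
    fin_cases i
    · exact ⟨hz0, hz0'⟩
    · exact ⟨hz1, hz1'⟩
  · refine AspectRenorm.mem_openCrossing_of_pathIn hnR hω P ?_ ?_
    · rw [mem_box]
      intro i
      fin_cases i
      · simpa using And.intro hr0 hr0'
      · simpa using And.intro hr1 hr1'
      · simp [hx2]
    · intro hmem
      rw [mem_box] at hmem
      have h2 := hmem 2
      simp only [Pi.sub_apply, Matrix.cons_val] at h2
      omega

/-- **The local crossing event is sure when `R < n`**: the corner `(R, R, R)` lies in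
`Λ(n) ∩ ∂ⁱⁿΛ(R)` and is joined to itself inside `Λ(R)` by the trivial path, so every
configuration lies in `cross(n, R)`. -/
theorem crossing_eq_univ_of_lt {n R : ℕ} (hRn : R < n) :
    {ω : BondConfig (Site 3) | ∃ x ∈ box 3 n, ∃ y ∈ innerBoundary (zdGraph 3) (box 3 R),
      ω ∈ openConnIn (↑(box 3 R) : Set (Site 3)) x y} = Set.univ := by
  refine Set.eq_univ_of_forall fun ω => ?_
  have hc : (fun _ => (R : ℤ) : Site 3) ∈ box 3 R := mem_box.2 fun _ => ⟨by omega, le_rfl⟩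
  refine ⟨fun _ => (R : ℤ), box_mono 3 hRn.le hc, fun _ => (R : ℤ),
    mem_innerBoundary_box_of_natAbs_eq hc (i := 0) (by simp), ?_⟩
  exact mem_openConnIn_of_pathIn (PathIn.refl (Finset.mem_coe.2 hc))

/-! ### Probability: Harris–FKG for the complements of the translated local crossings -/

/-- **Union of translated local crossings, by Harris–FKG.** For every finite set `I` of
translation vectors, `P_p(⋃_{v ∈ I} T_v) ≤ 1 - (1 - P_p(cross(n, R)))^{|I|}`: the events `T_v`
are increasing (`isUpperSet_openCrossing`) and local (`AspectRenorm.determinedBy_openCrossing_add`),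
so their complements are decreasing measurable events and
`P_p(⋂_v T_vᶜ) ≥ ∏_v P_p(T_vᶜ)` (`prob_biInter_ge_prod_of_isLowerSet`, Grimmett 1999, Thm. 2.4
for decreasing events), while `P_p(T_vᶜ) = 1 - P_p(cross(n, R))` by translation invariance
(`AspectRenorm.real_openCrossing_add`). -/
theorem real_biUnion_le_one_sub_pow (p : unitInterval) (n R : ℕ) (I : Finset (Site 3)) :
    (bondPercolation (zdGraph 3) p).real (⋃ v ∈ I,
        openCrossing ((· + v) '' (↑(box 3 R) : Set (Site 3)))
          ((· + v) '' (↑(box 3 n) : Set (Site 3)))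
          ((· + v) '' (↑(innerBoundary (zdGraph 3) (box 3 R)) : Set (Site 3)))) ≤
      1 - (1 - (bondPercolation (zdGraph 3) p).real
        {ω | ∃ x ∈ box 3 n, ∃ y ∈ innerBoundary (zdGraph 3) (box 3 R),
          ω ∈ openConnIn (↑(box 3 R) : Set (Site 3)) x y}) ^ I.card := by
  classical
  have hTm : ∀ v : Site 3, MeasurableSet (openCrossing ((· + v) '' (↑(box 3 R) : Set (Site 3)))
      ((· + v) '' (↑(box 3 n) : Set (Site 3)))
      ((· + v) '' (↑(innerBoundary (zdGraph 3) (box 3 R)) : Set (Site 3)))) := fun v =>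
    (AspectRenorm.determinedBy_openCrossing_add (n := n) v (S := (box 3 R).image (· + v))
      fun z hz => Finset.mem_image_of_mem _ hz).measurableSet_of_finset
  have hprod := prob_biInter_ge_prod_of_isLowerSet (zdGraph 3) p I
    (fun v => (openCrossing ((· + v) '' (↑(box 3 R) : Set (Site 3)))
      ((· + v) '' (↑(box 3 n) : Set (Site 3)))
      ((· + v) '' (↑(innerBoundary (zdGraph 3) (box 3 R)) : Set (Site 3))))ᶜ)
    (fun v _ => (isUpperSet_openCrossing _ _ _).compl) (fun v _ => (hTm v).compl)
  have hcompl : ∀ v ∈ I, (bondPercolation (zdGraph 3) p).real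
      (openCrossing ((· + v) '' (↑(box 3 R) : Set (Site 3)))
        ((· + v) '' (↑(box 3 n) : Set (Site 3)))
        ((· + v) '' (↑(innerBoundary (zdGraph 3) (box 3 R)) : Set (Site 3))))ᶜ =
      1 - (bondPercolation (zdGraph 3) p).real
        {ω | ∃ x ∈ box 3 n, ∃ y ∈ innerBoundary (zdGraph 3) (box 3 R),
          ω ∈ openConnIn (↑(box 3 R) : Set (Site 3)) x y} := fun v _ => by
    rw [probReal_compl_eq_one_sub (hTm v), AspectRenorm.real_openCrossing_add p v n R]
  rw [Finset.prod_congr rfl hcompl, Finset.prod_const] at hprod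
  have hU := probReal_compl_eq_one_sub (μ := bondPercolation (zdGraph 3) p)
    (Finset.measurableSet_biUnion I fun v _ => hTm v)
  rw [Set.compl_iUnion₂] at hU
  linarith

end SlabTiling

/-- **Registered stub `slabCrossing_le_of_tiling`** (line `critical-orange-peeling`, crux
`NearLinearTwoClusterDecay`, vdBvE programme V7a): for bond percolation on `ℤ³` (every `p`), every
`n ≥ 1`, `R + 1 ≤ 2h`, `h ≤ b`, the probability of a vertical open crossing of the slab box
`Λ(b) ∩ {|v₂| ≤ h}` (bottom layer to top layer, inside the slab box) is at most
`1 - (1 - P_p(cross(n, R)))^K`, `K = (2 ⌊b/n⌋ + 3)²`. Proof: on lattice configurations the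
crossing starts in some tile `c_z + Λ(n)`, `z ∈ box 2 (⌊b/n⌋ + 1)`, and must leave `c_z + Λ(R)`
(`SlabTiling.exists_tile_of_mem_slabCrossing`), so `V ⊆ ⋃_z T_{c_z}`; Harris–FKG for the
decreasing complements (`SlabTiling.real_biUnion_le_one_sub_pow`) and
`|box 2 (⌊b/n⌋ + 1)| = K` (`card_box`). For `R < n` the event `cross(n, R)` is sure and the bound
is `P_p(V) ≤ 1`. (The hypothesis `h ≤ b` is not needed.) -/
theorem slabCrossing_le_of_tiling : ∀ (p : unitInterval) (n R h b : ℕ), 1 ≤ n → R + 1 ≤ 2 * h → h ≤ b →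
    (bondPercolation (zdGraph 3) p).real
        {ω | ∃ x ∈ (box 3 b).filter (fun v => v 2 = -(h : ℤ)), ∃ y ∈ (box 3 b).filter (fun v => v 2 = (h : ℤ)),
          ω ∈ openConnIn (↑((box 3 b).filter (fun v => -(h : ℤ) ≤ v 2 ∧ v 2 ≤ (h : ℤ))) : Set (Site 3)) x y} ≤
      1 - (1 - (bondPercolation (zdGraph 3) p).real
        {ω | ∃ x ∈ box 3 n, ∃ y ∈ innerBoundary (zdGraph 3) (box 3 R),
          ω ∈ openConnIn (↑(box 3 R) : Set (Site 3)) x y}) ^ ((2 * (b / n) + 3) ^ 2) := by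
  classical
  intro p n R h b hn hRh _
  rcases le_or_gt n R with hnR | hRn
  · have hw0 : 0 ≤ 1 - (bondPercolation (zdGraph 3) p).real
        {ω | ∃ x ∈ box 3 n, ∃ y ∈ innerBoundary (zdGraph 3) (box 3 R),
          ω ∈ openConnIn (↑(box 3 R) : Set (Site 3)) x y} := sub_nonneg.2 measureReal_le_one
    have hw1 : 1 - (bondPercolation (zdGraph 3) p).real
        {ω | ∃ x ∈ box 3 n, ∃ y ∈ innerBoundary (zdGraph 3) (box 3 R),
          ω ∈ openConnIn (↑(box 3 R) : Set (Site 3)) x y} ≤ 1 := sub_le_self _ measureReal_nonneg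
    have hK : ((box 2 (b / n + 1)).image fun z : Site 2 =>
        (![(n : ℤ) * z 0, (n : ℤ) * z 1, -(h : ℤ)] : Site 3)).card ≤ (2 * (b / n) + 3) ^ 2 :=
      calc _ ≤ (box 2 (b / n + 1)).card := Finset.card_image_le
        _ = (2 * (b / n + 1) + 1) ^ 2 := card_box 2 _
        _ = (2 * (b / n) + 3) ^ 2 := by ring
    calc _ ≤ (bondPercolation (zdGraph 3) p).real (⋃ v ∈ (box 2 (b / n + 1)).image fun z : Site 2 =>
            (![(n : ℤ) * z 0, (n : ℤ) * z 1, -(h : ℤ)] : Site 3),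
          openCrossing ((· + v) '' (↑(box 3 R) : Set (Site 3)))
            ((· + v) '' (↑(box 3 n) : Set (Site 3)))
            ((· + v) '' (↑(innerBoundary (zdGraph 3) (box 3 R)) : Set (Site 3)))) := by
          refine real_mono_of_forall_subset_edgeSet (zdGraph 3) p fun ω hω hV => ?_
          obtain ⟨z, hz, hT⟩ := SlabTiling.exists_tile_of_mem_slabCrossing hn hnR hRh hω hV
          exact Set.mem_biUnion (Finset.mem_coe.2 (Finset.mem_image_of_mem _ hz)) hT
      _ ≤ _ := SlabTiling.real_biUnion_le_one_sub_pow p n R _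
      _ ≤ _ := by linarith [pow_le_pow_of_le_one hw0 hw1 hK]
  · rw [SlabTiling.crossing_eq_univ_of_lt hRn, probReal_univ, sub_self,
      zero_pow (pow_ne_zero 2 (by omega)), sub_zero]
    exact measureReal_le_one

end Summit.CriticalPhenomena.PercolationContinuityZ3.Theorems.NearLinearTwoClusterDecay.Negative

end
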